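import Summits.QuantumFields.GaugeBoot.TimeAxisLoops
import HarnessLib

/-!
# Gauge-boot / ym-instrument: reflection-positivity HANKEL blocks for time correlators of spatial loops

Cell `ym-instrument` (HUMAN RULING D-0084 (2); director-ym R138; HOME `run/shared/lean/pub/ym-instrument/`), crew (a),
Lean typist seat `ym-instrument-boot-lean-1`; file 2/3 of the answer to the pre-registered question **Q-A2 (α)**
(«positivity-only lower bound on the connected plaquette–plaquette correlator decay at fixed β»; BOOT-PLAN §5.1,
R-A2.0, 0 core-h). Theorems only (vocabulary: `TimeAxisLoops`).

HONEST FRAMING (page 1 of every file of this cell): no number, no certificate. These are EXACT inequalities between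
finitely many lattice expectations on the torus `(ℤ/L)^d`, `L` even, at STATED coupling (any real `β` for the site
blocks, `β ≥ 0` for the link blocks), any compact `G` and continuous `ρ`; NOT a mass gap, NOT a continuum limit, NOT
a string tension, no `L → ∞` statement (that is file 3/3 and the Instrument file `PlaquettePairDecay`); nothing here
is summit-bearing.

## Content

For a finite family of SPATIAL words `W_p` (no step along the time axis `0`) placed at heights `h_p` on the time axis
and real coefficients `c_p`, reflection positivity of the torus Wilson state applied to the real observable
`F = Σ_p c_p W_{(h_p,0⃗)}(W_p)` gives (the reflection moves a spatial loop rigidly along the time axis):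
* `sum_mul_wilsonExpectation_wordLoop_mul_nonneg_site` / `hankel_wordLoop_mul_nonneg_site` (heights `h_p ≤ L/2`, any
  real `β`): `0 ≤ Σ_{p,q} c_p c_q ⟨W_0(W_p) · W_{(h_p+h_q,0⃗)}(W_q)⟩_β` — the HANKEL block in the time separation;
* `sum_mul_wilsonExpectation_wordLoop_mul_nonneg_link` / `hankel_wordLoop_mul_nonneg_link` (`h_p + 1 ≤ L/2`, `β ≥ 0`):
  `0 ≤ Σ_{p,q} c_p c_q ⟨W_0(W_p) · W_{(h_p+h_q+1,0⃗)}(W_q)⟩_β` — the SHIFTED Hankel block;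
* adjoining the constant observable (the empty word) and optimising its coefficient
  (`sum_mul_sub_sq_nonneg_of_affine`): for ONE spatial word `w` with `u = ⟨W_0(w)⟩` and
  `K(t) = ⟨W_0(w) W_{(t,0⃗)}(w)⟩`, the CONNECTED blocks `0 ≤ Σ_{a,b∈S} c_a c_b (K(a+b) - u²)` (`a ≤ L/2`, any `β`;
  `hankel_wordLoop_connected_nonneg_site`) and `0 ≤ Σ_{a,b∈S} c_a c_b (K(a+b+1) - u²)` (`a + 1 ≤ L/2`, `β ≥ 0`;
  `hankel_wordLoop_connected_nonneg_link`), with their affine forms `hankel_wordLoop_affine_nonneg_site/link`.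

These are the finite-volume content of "the transfer matrix is a positive self-adjoint contraction" (Osterwalder–Seiler
1978 §2; Seiler LNP 159 Ch. 2; Montvay–Münster §3.2.6, §3.2.8): on the torus only the blocks of heights `≤ L/2` hold
(wrap-around), the full Hankel / Stieltjes structure appears at infinite-volume limit points (Instrument file
`PlaquettePairDecay`). Mechanism identical to the tree's `gram_wilsonLoop_nonneg_even/odd` for rectangles
(`ConstructiveQFTWave0WilsonLoopRPProofs`), with products of two traces instead of one bisected loop. `[folklore]`.
-/

noncomputable section

open MeasureTheory ComplexConjugate
open scoped ComplexOrder
open Literature.MathematicalPhysics.QuantumFieldTheory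
open Literature.RepresentationTheory.CompactGroups

namespace Summit.QuantumFields.GaugeBoot

/-! ## The Hankel blocks: time correlators of spatial loops -/

section Blocks

variable {d L N : ℕ} [NeZero d] [NeZero L] {G : Type*} [Group G] [TopologicalSpace G]
  [IsTopologicalGroup G] [CompactSpace G] [MeasurableSpace G] [BorelSpace G]
  (ρ : G →* Matrix (Fin N) (Fin N) ℂ)

/-- **Site block for time correlators of spatial loops.** For `L` even, ANY real `β`, continuous `ρ`, a finite
family of spatial words `W_p` at heights `h_p ≤ L/2` and real coefficients `c_p`:
`0 ≤ Σ_{p,q} c_p c_q ⟨W_{(-h_p,0⃗)}(W_p) · W_{(h_q,0⃗)}(W_q)⟩_β` — Osterwalder–Seiler site-reflection positivity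
(tree `wilsonExpectation_siteReflectionPositive`) applied to the real observable `Σ_p c_p W_{(h_p,0⃗)}(W_p)`. [folklore] -/
theorem sum_mul_wilsonExpectation_wordLoop_mul_nonneg_site (hL : Even L) (hρ : Continuous ρ) (β : ℝ)
    {ι : Type*} (T : Finset ι) (h : ι → ℕ) (W : ι → Word d) (c : ι → ℝ)
    (hW : ∀ p ∈ T, (W p).isSpatial = true) (hh : ∀ p ∈ T, h p ≤ L / 2) :
    0 ≤ ∑ p ∈ T, ∑ q ∈ T, c p * c q *
      wilsonExpectation ρ β (fun U : GaugeConfig d L G =>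
        wordLoop ρ (tSite (-(h p : ℤ))) (W p) U * wordLoop ρ (tSite (h q : ℤ)) (W q) U) := by
  set f : GaugeConfig d L G → ℝ := fun U => ∑ p ∈ T, c p * wordLoop ρ (tSite (h p : ℤ)) (W p) U with hfdef
  have hf : Measurable f := Finset.measurable_sum _ fun p _ => (measurable_wordLoop ρ hρ _ _).const_mul _
  have hfb : ∀ U, |f U| ≤ ∑ p ∈ T, |c p| := fun U => by
    refine (Finset.abs_sum_le_sum_abs _ _).trans (Finset.sum_le_sum fun p _ => ?_)
    rw [abs_mul]
    exact mul_le_of_le_one_right (abs_nonneg _) (abs_wordLoop_le_one ρ hρ _ _ U)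
  have hfdep : DependsOn f
      ((WilsonSiteRP.sitePosEdges ∪ WilsonSiteRP.sharedEdges : Finset (Edge d L)) : Set (Edge d L)) := by
    intro U V hUV
    refine Finset.sum_congr rfl fun p hp => ?_
    have hd := dependsOn_wordLoop_tSite (G := G) ρ (hW p hp) (hh p hp) hUV
    rw [hd]
  have h0 := wilsonExpectation_negReflect_mul_self_nonneg ρ hL hρ β f hf ⟨_, hfb⟩ hfdep
  have hneg : ∀ U : GaugeConfig d L G, f U.negReflect = ∑ p ∈ T, c p * wordLoop ρ (tSite (-(h p : ℤ))) (W p) U :=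
    fun U => Finset.sum_congr rfl fun p hp => by rw [wordLoop_tSite_negReflect ρ (hW p hp)]
  have hid : (fun U : GaugeConfig d L G => f U.negReflect * f U) = fun U =>
      (∑ p ∈ T, c p * wordLoop ρ (tSite (-(h p : ℤ))) (W p) U) * ∑ q ∈ T, c q * wordLoop ρ (tSite (h q : ℤ)) (W q) U := by
    funext U; rw [hneg]
  rw [hid, wilsonExpectation_sum_mul_sum ρ β T c _ _ fun p _ q _ => integrable_wordLoop_mul ρ hρ β _ _ _ _] at h0
  exact h0

/-- **Site block, translated to the origin**: `0 ≤ Σ_{p,q} c_p c_q ⟨W_0(W_p) · W_{(h_p+h_q,0⃗)}(W_q)⟩_β` — the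
Hankel form in the separation `h_p + h_q` (translation invariance of the torus Wilson state). [folklore] -/
theorem hankel_wordLoop_mul_nonneg_site (hL : Even L) (hρ : Continuous ρ) (β : ℝ)
    {ι : Type*} (T : Finset ι) (h : ι → ℕ) (W : ι → Word d) (c : ι → ℝ)
    (hW : ∀ p ∈ T, (W p).isSpatial = true) (hh : ∀ p ∈ T, h p ≤ L / 2) :
    0 ≤ ∑ p ∈ T, ∑ q ∈ T, c p * c q *
      wilsonExpectation ρ β (fun U : GaugeConfig d L G =>
        wordLoop ρ 0 (W p) U * wordLoop ρ (tSite ((h p + h q : ℕ) : ℤ)) (W q) U) := by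
  have h0 := sum_mul_wilsonExpectation_wordLoop_mul_nonneg_site ρ hL hρ β T h W c hW hh
  refine h0.trans_eq (Finset.sum_congr rfl fun p _ => Finset.sum_congr rfl fun q _ => ?_)
  have e1 : (tSite (-(h p : ℤ)) + tSite (h p : ℤ) : Site d L) = 0 := by
    rw [← tSite_add, neg_add_cancel, tSite_zero]
  have e2 : (tSite (h q : ℤ) + tSite (h p : ℤ) : Site d L) = tSite ((h p + h q : ℕ) : ℤ) := by
    rw [← tSite_add]; congr 1; push_cast; ring
  rw [wilsonExpectation_wordLoop_mul_translate ρ β _ _ (tSite (h p : ℤ)), e1, e2]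

/-- **Link block for time correlators of spatial loops.** For `L` even, `β ≥ 0`, continuous `ρ`, spatial words
`W_p` at heights `h_p + 1 ≤ L/2` and real `c_p`:
`0 ≤ Σ_{p,q} c_p c_q ⟨W_{(-h_p,0⃗)}(W_p) · W_{(h_q+1,0⃗)}(W_q)⟩_β` — Osterwalder–Seiler reflection positivity in the
hyperplane between time slices (tree `wilsonExpectation_reflectionPositive_holds`) applied to the positive-time
observable `Σ_p c_p W_{(h_p+1,0⃗)}(W_p)`. [folklore] -/
theorem sum_mul_wilsonExpectation_wordLoop_mul_nonneg_link (hL : Even L) (hρ : Continuous ρ) {β : ℝ}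
    (hβ : 0 ≤ β) {ι : Type*} (T : Finset ι) (h : ι → ℕ) (W : ι → Word d) (c : ι → ℝ)
    (hW : ∀ p ∈ T, (W p).isSpatial = true) (hh : ∀ p ∈ T, h p + 1 ≤ L / 2) :
    0 ≤ ∑ p ∈ T, ∑ q ∈ T, c p * c q *
      wilsonExpectation ρ β (fun U : GaugeConfig d L G =>
        wordLoop ρ (tSite (-(h p : ℤ))) (W p) U * wordLoop ρ (tSite ((h q + 1 : ℕ) : ℤ)) (W q) U) := by
  haveI : Fact (1 < L) := ⟨by obtain ⟨r, hr⟩ := hL; have := NeZero.ne L; omega⟩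
  set f : GaugeConfig d L G → ℝ := fun U => ∑ p ∈ T, c p * wordLoop ρ (tSite ((h p + 1 : ℕ) : ℤ)) (W p) U
    with hfdef
  have hf : Measurable f := Finset.measurable_sum _ fun p _ => (measurable_wordLoop ρ hρ _ _).const_mul _
  have hfb : ∀ U, |f U| ≤ ∑ p ∈ T, |c p| := fun U => by
    refine (Finset.abs_sum_le_sum_abs _ _).trans (Finset.sum_le_sum fun p _ => ?_)
    rw [abs_mul]
    exact mul_le_of_le_one_right (abs_nonneg _) (abs_wordLoop_le_one ρ hρ _ _ U)
  have hfpos : IsPositiveTimeObservable f := by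
    intro U V hUV
    refine Finset.sum_congr rfl fun p hp => ?_
    rw [isPositiveTimeObservable_wordLoop_tSite (G := G) ρ (hW p hp) (by omega) (hh p hp) U V hUV]
  have h0 := wilsonExpectation_timeReflect_mul_self_nonneg ρ hL hρ hβ f hf ⟨_, hfb⟩ hfpos
  have hneg : ∀ U : GaugeConfig d L G, f U.timeReflect = ∑ p ∈ T, c p * wordLoop ρ (tSite (-(h p : ℤ))) (W p) U :=
    fun U => Finset.sum_congr rfl fun p hp => by
      rw [wordLoop_tSite_timeReflect ρ (hW p hp)]
      congr 3; push_cast; ring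
  have hid : (fun U : GaugeConfig d L G => f U.timeReflect * f U) = fun U =>
      (∑ p ∈ T, c p * wordLoop ρ (tSite (-(h p : ℤ))) (W p) U) *
        ∑ q ∈ T, c q * wordLoop ρ (tSite ((h q + 1 : ℕ) : ℤ)) (W q) U := by
    funext U; rw [hneg]
  rw [hid, wilsonExpectation_sum_mul_sum ρ β T c _ _ fun p _ q _ => integrable_wordLoop_mul ρ hρ β _ _ _ _] at h0
  exact h0

/-- **Link block, translated to the origin**: `0 ≤ Σ_{p,q} c_p c_q ⟨W_0(W_p) · W_{(h_p+h_q+1,0⃗)}(W_q)⟩_β`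
(`β ≥ 0`) — the shifted Hankel form. [folklore] -/
theorem hankel_wordLoop_mul_nonneg_link (hL : Even L) (hρ : Continuous ρ) {β : ℝ} (hβ : 0 ≤ β)
    {ι : Type*} (T : Finset ι) (h : ι → ℕ) (W : ι → Word d) (c : ι → ℝ)
    (hW : ∀ p ∈ T, (W p).isSpatial = true) (hh : ∀ p ∈ T, h p + 1 ≤ L / 2) :
    0 ≤ ∑ p ∈ T, ∑ q ∈ T, c p * c q *
      wilsonExpectation ρ β (fun U : GaugeConfig d L G =>
        wordLoop ρ 0 (W p) U * wordLoop ρ (tSite ((h p + h q + 1 : ℕ) : ℤ)) (W q) U) := by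
  have h0 := sum_mul_wilsonExpectation_wordLoop_mul_nonneg_link ρ hL hρ hβ T h W c hW hh
  refine h0.trans_eq (Finset.sum_congr rfl fun p _ => Finset.sum_congr rfl fun q _ => ?_)
  have e1 : (tSite (-(h p : ℤ)) + tSite (h p : ℤ) : Site d L) = 0 := by
    rw [← tSite_add, neg_add_cancel, tSite_zero]
  have e2 : (tSite ((h q + 1 : ℕ) : ℤ) + tSite (h p : ℤ) : Site d L) = tSite ((h p + h q + 1 : ℕ) : ℤ) := by
    rw [← tSite_add]; congr 1; push_cast; ring
  rw [wilsonExpectation_wordLoop_mul_translate ρ β _ _ (tSite (h p : ℤ)), e1, e2]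

end Blocks

/-! ## One spatial loop and the constant: the Hankel blocks of the CONNECTED time correlator -/

section Connected

variable {d L N : ℕ} [NeZero d] [NeZero L] {G : Type*} [Group G] [TopologicalSpace G]
  [IsTopologicalGroup G] [CompactSpace G] [MeasurableSpace G] [BorelSpace G]
  (ρ : G →* Matrix (Fin N) (Fin N) ℂ)

omit [NeZero d] [NeZero L] [TopologicalSpace G] [IsTopologicalGroup G] [CompactSpace G] [MeasurableSpace G]
  [BorelSpace G] in
/-- From the affine family (constant adjoined) to the connected Hankel block: if
`0 ≤ c₀² + 2 c₀ (Σ_a c_a) u + Σ_{a,b} c_a c_b G(a,b)` for every real `c₀`, then (taking `c₀ = -u Σ_a c_a`)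
`0 ≤ Σ_{a,b} c_a c_b (G(a,b) - u²)`. [folklore] -/
theorem sum_mul_sub_sq_nonneg_of_affine {S : Finset ℕ} {c : ℕ → ℝ} {u : ℝ} {K : ℕ → ℕ → ℝ}
    (h : ∀ c₀ : ℝ, 0 ≤ c₀ ^ 2 + 2 * c₀ * (∑ a ∈ S, c a) * u + ∑ a ∈ S, ∑ b ∈ S, c a * c b * K a b) :
    0 ≤ ∑ a ∈ S, ∑ b ∈ S, c a * c b * (K a b - u ^ 2) := by
  have h0 := h (-(u * ∑ a ∈ S, c a))
  have hsplit : ∑ a ∈ S, ∑ b ∈ S, c a * c b * (K a b - u ^ 2) =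
      ∑ a ∈ S, ∑ b ∈ S, c a * c b * K a b - u ^ 2 * ((∑ a ∈ S, c a) * ∑ b ∈ S, c b) := by
    rw [Finset.sum_mul_sum, Finset.mul_sum, ← Finset.sum_sub_distrib]
    refine Finset.sum_congr rfl fun a _ => ?_
    rw [Finset.mul_sum, ← Finset.sum_sub_distrib]
    exact Finset.sum_congr rfl fun b _ => by ring
  rw [hsplit]
  nlinarith [h0]

/-- **Affine site block for one spatial loop** (`L` even, any real `β`, `N ≥ 1` not needed): for a spatial word
`w`, heights `a ≤ L/2` (`a ∈ S`), reals `c₀, c_a`, with `u = ⟨W_0(w)⟩` and `K(t) = ⟨W_0(w) · W_{(t,0⃗)}(w)⟩`: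
`0 ≤ c₀² + 2 c₀ (Σ_a c_a) u + Σ_{a,b} c_a c_b K(a+b)` — the site block of the family `{1} ∪ {W_{(a,0⃗)}(w)}`.
[folklore] -/
theorem hankel_wordLoop_affine_nonneg_site (hL : Even L) (hρ : Continuous ρ) (β : ℝ) {w : Word d}
    (hw : w.isSpatial = true) (S : Finset ℕ) (hS : ∀ a ∈ S, a ≤ L / 2) (c₀ : ℝ) (c : ℕ → ℝ) :
    0 ≤ c₀ ^ 2 + 2 * c₀ * (∑ a ∈ S, c a) * wilsonExpectation ρ β (wordLoop ρ (0 : Site d L) w) +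
      ∑ a ∈ S, ∑ b ∈ S, c a * c b *
        wilsonExpectation ρ β (fun U : GaugeConfig d L G =>
          wordLoop ρ 0 w U * wordLoop ρ (tSite ((a + b : ℕ) : ℤ)) w U) := by
  rcases Nat.eq_zero_or_pos N with hN | hN
  · subst hN
    simp [wordLoop, wilsonExpectation]
    positivity
  haveI := isProbabilityMeasure_wilsonMeasure (d := d) (L := L) (G := G) ρ hρ β
  set u := wilsonExpectation ρ β (wordLoop ρ (0 : Site d L) w) with hudef
  have hu : ∀ t : ℤ, wilsonExpectation ρ β (wordLoop (G := G) ρ (tSite t : Site d L) w) = u := fun t =>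
    wilsonExpectation_wordLoop_translate ρ β _ _ w
  have h0 := hankel_wordLoop_mul_nonneg_site ρ hL hρ β (Finset.insertNone S) (fun o => o.elim 0 id)
    (fun o => o.elim [] fun _ => w) (fun o => o.elim c₀ c)
    (by intro p hp; cases p with
      | none => exact Word.isSpatial_nil
      | some a => exact hw)
    (by intro p hp; cases p with
      | none => exact Nat.zero_le _
      | some a => exact hS a (Finset.some_mem_insertNone.1 hp))
  simp only [Finset.sum_insertNone, Option.elim, id, zero_add, add_zero, wordLoop_nil ρ hN.ne', one_mul,
    mul_one, hu] at h0
  have h1 : wilsonExpectation ρ β (fun _ : GaugeConfig d L G => (1 : ℝ)) = 1 := by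
    simp only [wilsonExpectation, integral_const, smul_eq_mul, mul_one, probReal_univ]
  rw [h1] at h0
  have e1 : ∑ b ∈ S, c₀ * c b * u = c₀ * u * ∑ b ∈ S, c b := by
    rw [Finset.mul_sum]; exact Finset.sum_congr rfl fun b _ => by ring
  have e2 : ∑ a ∈ S, (c a * c₀ * u + ∑ b ∈ S, c a * c b *
      wilsonExpectation ρ β (fun U : GaugeConfig d L G => wordLoop ρ 0 w U * wordLoop ρ (tSite ((a + b : ℕ) : ℤ)) w U)) =
      c₀ * u * (∑ a ∈ S, c a) + ∑ a ∈ S, ∑ b ∈ S, c a * c b *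
        wilsonExpectation ρ β (fun U : GaugeConfig d L G => wordLoop ρ 0 w U * wordLoop ρ (tSite ((a + b : ℕ) : ℤ)) w U) := by
    rw [Finset.sum_add_distrib, Finset.mul_sum]
    congr 1
    exact Finset.sum_congr rfl fun a _ => by ring
  rw [e1, e2] at h0
  nlinarith [h0]

/-- **Connected site Hankel block for one spatial loop**: for `L` even, any real `β`, a spatial word `w` and
heights `a ≤ L/2`: `0 ≤ Σ_{a,b ∈ S} c_a c_b (⟨W_0(w) W_{(a+b,0⃗)}(w)⟩ - ⟨W_0(w)⟩²)`, i.e. the Hankel matrix of the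
CONNECTED time correlator of `w` is positive semi-definite on heights `≤ L/2` — EXACT on the torus. [folklore] -/
theorem hankel_wordLoop_connected_nonneg_site (hL : Even L) (hρ : Continuous ρ) (β : ℝ) {w : Word d}
    (hw : w.isSpatial = true) (S : Finset ℕ) (hS : ∀ a ∈ S, a ≤ L / 2) (c : ℕ → ℝ) :
    0 ≤ ∑ a ∈ S, ∑ b ∈ S, c a * c b *
      (wilsonExpectation ρ β (fun U : GaugeConfig d L G =>
          wordLoop ρ 0 w U * wordLoop ρ (tSite ((a + b : ℕ) : ℤ)) w U) -
        wilsonExpectation ρ β (wordLoop ρ (0 : Site d L) w) ^ 2) :=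
  sum_mul_sub_sq_nonneg_of_affine (K := fun a b => wilsonExpectation ρ β (fun U : GaugeConfig d L G =>
    wordLoop ρ 0 w U * wordLoop ρ (tSite ((a + b : ℕ) : ℤ)) w U))
    fun c₀ => hankel_wordLoop_affine_nonneg_site ρ hL hρ β hw S hS c₀ c

/-- **Affine link block for one spatial loop** (`L` even, `β ≥ 0`): heights `a + 1 ≤ L/2`,
`0 ≤ c₀² + 2 c₀ (Σ_a c_a) u + Σ_{a,b} c_a c_b K(a+b+1)`. [folklore] -/
theorem hankel_wordLoop_affine_nonneg_link (hL : Even L) (hρ : Continuous ρ) {β : ℝ} (hβ : 0 ≤ β) {w : Word d}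
    (hw : w.isSpatial = true) (S : Finset ℕ) (hS : ∀ a ∈ S, a + 1 ≤ L / 2) (c₀ : ℝ) (c : ℕ → ℝ) :
    0 ≤ c₀ ^ 2 + 2 * c₀ * (∑ a ∈ S, c a) * wilsonExpectation ρ β (wordLoop ρ (0 : Site d L) w) +
      ∑ a ∈ S, ∑ b ∈ S, c a * c b *
        wilsonExpectation ρ β (fun U : GaugeConfig d L G =>
          wordLoop ρ 0 w U * wordLoop ρ (tSite ((a + b + 1 : ℕ) : ℤ)) w U) := by
  rcases Nat.eq_zero_or_pos N with hN | hN
  · subst hN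
    simp [wordLoop, wilsonExpectation]
    positivity
  haveI := isProbabilityMeasure_wilsonMeasure (d := d) (L := L) (G := G) ρ hρ β
  have h2L : 1 ≤ L / 2 := by obtain ⟨r, hr⟩ := hL; have := NeZero.ne L; omega
  set u := wilsonExpectation ρ β (wordLoop ρ (0 : Site d L) w) with hudef
  have hu : ∀ t : ℤ, wilsonExpectation ρ β (wordLoop (G := G) ρ (tSite t : Site d L) w) = u := fun t =>
    wilsonExpectation_wordLoop_translate ρ β _ _ w
  have h0 := hankel_wordLoop_mul_nonneg_link ρ hL hρ hβ (Finset.insertNone S) (fun o => o.elim 0 id)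
    (fun o => o.elim [] fun _ => w) (fun o => o.elim c₀ c)
    (by intro p hp; cases p with
      | none => exact Word.isSpatial_nil
      | some a => exact hw)
    (by intro p hp; cases p with
      | none => exact h2L
      | some a => exact hS a (Finset.some_mem_insertNone.1 hp))
  simp only [Finset.sum_insertNone, Option.elim, id, zero_add, wordLoop_nil ρ hN.ne', one_mul,
    mul_one, hu] at h0
  have h1 : wilsonExpectation ρ β (fun _ : GaugeConfig d L G => (1 : ℝ)) = 1 := by
    simp only [wilsonExpectation, integral_const, smul_eq_mul, mul_one, probReal_univ]
  rw [h1] at h0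
  have e1 : ∑ b ∈ S, c₀ * c b * u = c₀ * u * ∑ b ∈ S, c b := by
    rw [Finset.mul_sum]; exact Finset.sum_congr rfl fun b _ => by ring
  have e2 : ∑ a ∈ S, (c a * c₀ * u + ∑ b ∈ S, c a * c b *
      wilsonExpectation ρ β (fun U : GaugeConfig d L G =>
        wordLoop ρ 0 w U * wordLoop ρ (tSite ((a + b + 1 : ℕ) : ℤ)) w U)) =
      c₀ * u * (∑ a ∈ S, c a) + ∑ a ∈ S, ∑ b ∈ S, c a * c b *
        wilsonExpectation ρ β (fun U : GaugeConfig d L G =>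
          wordLoop ρ 0 w U * wordLoop ρ (tSite ((a + b + 1 : ℕ) : ℤ)) w U) := by
    rw [Finset.sum_add_distrib, Finset.mul_sum]
    congr 1
    exact Finset.sum_congr rfl fun a _ => by ring
  rw [e1, e2] at h0
  nlinarith [h0]

/-- **Connected link Hankel block for one spatial loop**: for `L` even, `β ≥ 0`, a spatial word `w` and heights
`a + 1 ≤ L/2`: `0 ≤ Σ_{a,b ∈ S} c_a c_b (⟨W_0(w) W_{(a+b+1,0⃗)}(w)⟩ - ⟨W_0(w)⟩²)` — the SHIFTED Hankel matrix
of the connected time correlator is positive semi-definite; EXACT on the torus. [folklore] -/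
theorem hankel_wordLoop_connected_nonneg_link (hL : Even L) (hρ : Continuous ρ) {β : ℝ} (hβ : 0 ≤ β)
    {w : Word d} (hw : w.isSpatial = true) (S : Finset ℕ) (hS : ∀ a ∈ S, a + 1 ≤ L / 2) (c : ℕ → ℝ) :
    0 ≤ ∑ a ∈ S, ∑ b ∈ S, c a * c b *
      (wilsonExpectation ρ β (fun U : GaugeConfig d L G =>
          wordLoop ρ 0 w U * wordLoop ρ (tSite ((a + b + 1 : ℕ) : ℤ)) w U) -
        wilsonExpectation ρ β (wordLoop ρ (0 : Site d L) w) ^ 2) :=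
  sum_mul_sub_sq_nonneg_of_affine (K := fun a b => wilsonExpectation ρ β (fun U : GaugeConfig d L G =>
    wordLoop ρ 0 w U * wordLoop ρ (tSite ((a + b + 1 : ℕ) : ℤ)) w U))
    fun c₀ => hankel_wordLoop_affine_nonneg_link ρ hL hρ hβ hw S hS c₀ c

end Connected

end Summit.QuantumFields.GaugeBoot

end
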